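import Summits.HubbardSuperconductivity.HubbardSuperconductivity.Theorems.AnisotropyChordTransferFibre3Lam2Small
import Summits.HubbardSuperconductivity.HubbardSuperconductivity.Theorems.AnisotropyChordTransferFibre3ProfileFromGreen
import Summits.HubbardSuperconductivity.HubbardSuperconductivity.Theorems.AnisotropyChordTransferFibre3GroundState

/-!
# Route `AnisotropyChord` / H0 rotor rung: the a-priori SUP BOUND on the ground two-magnon profile (`f ≤ 2`, every `L ≥ 5`)

Regime facts of the GM₃ ∀L certificate (rung stmt-HubbardSuperconductivity-19089; `f_max` is a Level-2 input of
(KT-2b)/`Cs2RealSpaceBound`/`C0FreeBound`, LEVEL2-SPEC §3).  From p3's real-space profile formula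
`f(r) = 1 + Δf(x̂)/V − c_s G̃_{λ₂}(r)` (`profileFromGreen_holds`), the bound `|G̃_λ(r)| ≤ G̃_λ(0)` (positive symbol), the
Green-zero identity and the sum rule — all unconditional now that `λ₂ < 2ε₁` is a theorem (`lam2_lt_two_eps1`):
* `gres_nonneg_of_lt`, `abs_Gres_le`: `|G̃_λ(r)| ≤ G̃_λ(0)` for `λ < 2ε₁`;
* `cS_mul_Gres_zero`: `c_s·G̃_{λ₂}(0) = 1 + Δf(x̂)/V − Δf(x̂)` for the ground profile;
* ★★ `ground_le_two_of_ne`/`ground_le_two'`: **`f(r) ≤ 2 − Δ·f(x̂)·(1 − 2/V)`**, `ground_le_two`: **`f ≤ 2`** (mean one, `f(0) = 0`), and the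
  companion `ground_ge_delta_mul` (`f(r) ≥ Δ f(x̂)` off the origin);
* `sum_ground_sq_le`: `Σ_r f(r)² ≤ 2V`; `fnn_le_two`, `etaEff_le_two`: `f(x̂) ≤ 2`, `η_eff ≤ 2(1−Δ)`.
Prover seat `hubbard-h0-rotor-p1` g24; helper for stmt-HubbardSuperconductivity-19089 (`--supports`).
-/

set_option linter.dupNamespace false
set_option autoImplicit false

noncomputable section

open scoped BigOperators
open Complex

namespace Summit.HubbardSuperconductivity.HubbardSuperconductivity.Theorems.AnisotropyChord.Transfer.Fibre3

variable (L : ℕ) [NeZero L]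

/-! ## `|G̃_λ(r)| ≤ G̃_λ(0)` -/

/-- `g_λ(k) ≥ 0` for `λ < 2ε₁` (`L ≥ 2`). [folklore] -/
theorem gres_nonneg_of_lt (hL : 2 ≤ L) {lam2 : ℝ} (hlam : lam2 < 2 * eps1 L) (k : Tor L) : 0 ≤ gres L lam2 k := by
  unfold gres
  by_cases hk : k = 0
  · rw [if_pos hk]
  · rw [if_neg hk]
    have h1 := eps1_le_epsT L hL hk
    have : 0 < 2 * epsT L k - lam2 := by linarith
    positivity

/-- `|Re φ_k(r)| ≤ 1`. [folklore] -/
theorem abs_re_phase_le (k r : Tor L) : |(phase L k r).re| ≤ 1 := by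
  have h := Complex.abs_re_le_norm (phase L k r)
  rwa [norm_phase] at h

/-- ★ `|G̃_λ(r)| ≤ G̃_λ(0)` for `λ < 2ε₁` (the symbol is positive), `L ≥ 2`. [folklore] -/
theorem abs_Gres_le (hL : 2 ≤ L) {lam2 : ℝ} (hlam : lam2 < 2 * eps1 L) (r : Tor L) :
    |Gres L lam2 r| ≤ Gres L lam2 0 := by
  rw [Gres_zero_eq]
  unfold Gres
  have hV : (0 : ℝ) < (L : ℝ) ^ 2 := by
    have : (0 : ℝ) < L := by exact_mod_cast (show 0 < L by omega)
    positivity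
  rw [abs_div, abs_of_pos hV]
  apply div_le_div_of_nonneg_right _ hV.le
  calc |∑ k : Tor L, gres L lam2 k * (phase L k r).re|
      ≤ ∑ k : Tor L, |gres L lam2 k * (phase L k r).re| := Finset.abs_sum_le_sum_abs _ _
    _ ≤ ∑ k : Tor L, gres L lam2 k := by
        refine Finset.sum_le_sum fun k _ => ?_
        rw [abs_mul, abs_of_nonneg (gres_nonneg_of_lt L hL hlam k)]
        have h1 := abs_re_phase_le L k r
        have h2 := gres_nonneg_of_lt L hL hlam k
        nlinarith

/-! ## The contact constant against the Green's function at the origin -/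

/-- ★ `c_s·G̃_{λ₂}(0) = 1 + Δf(x̂)/V − Δf(x̂)` for the ground profile (`L ≥ 5`, `0 ≤ Δ < 1`; Green-zero identity + sum rule). [folklore] -/
theorem cS_mul_Gres_zero (hL : 5 ≤ L) {Δ lam2 : ℝ} (hΔ0 : 0 ≤ Δ) (hΔ1 : Δ < 1) {f : Tor L → ℝ}
    (hf : IsGroundTwoMagnon L Δ lam2 f) :
    cS L Δ lam2 f * Gres L lam2 0 = 1 + Δ * f (K1 L) / (L : ℝ) ^ 2 - Δ * f (K1 L) := by
  have hpos := lam2_pos L (by omega) hΔ1 hf.1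
  have hlt := lam2_lt_two_eps1 L hL hΔ0 hf
  have hG := greenZeroIdentity_holds L (by omega) Δ lam2 f hf.1 hpos hlt
  rw [← Gres_zero_zero_eq_sum_erase] at hG
  have hsr := lam2_sum_rule L (by omega) hf.1
  have hV : (0 : ℝ) < (L : ℝ) ^ 2 := by
    have : (0 : ℝ) < L := by exact_mod_cast (show 0 < L by omega)
    positivity
  have hden : 0 < 4 * (1 - Δ) + Δ * lam2 := by nlinarith
  unfold cS
  rw [hG, mul_sub]
  have e1 : f (K1 L) * (4 * (1 - Δ) + Δ * lam2) * (1 / ((L : ℝ) ^ 2 * lam2))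
      = 1 + Δ * f (K1 L) / (L : ℝ) ^ 2 := by
    have : f (K1 L) * (4 * (1 - Δ) + Δ * lam2) = lam2 * (L : ℝ) ^ 2 + Δ * lam2 * f (K1 L) := by
      linear_combination (-1 : ℝ) * hsr
    rw [this]
    field_simp
  have e2 : f (K1 L) * (4 * (1 - Δ) + Δ * lam2) * (Δ / (4 * (1 - Δ) + Δ * lam2)) = Δ * f (K1 L) := by
    field_simp
  rw [e1, e2]

/-! ## The sup bound -/

/-- off the origin: `f(r) ≤ 2 − Δ·f(x̂)·(1 − 2/V)` (`L ≥ 5`, `0 ≤ Δ < 1`, `r ≠ 0`). [folklore] -/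
theorem ground_le_two_of_ne (hL : 5 ≤ L) {Δ lam2 : ℝ} (hΔ0 : 0 ≤ Δ) (hΔ1 : Δ < 1) {f : Tor L → ℝ}
    (hf : IsGroundTwoMagnon L Δ lam2 f) {r : Tor L} (hr : r ≠ 0) :
    f r ≤ 2 - Δ * f (K1 L) * (1 - 2 / (L : ℝ) ^ 2) := by
  have hpos := lam2_pos L (by omega) hΔ1 hf.1
  have hlt := lam2_lt_two_eps1 L hL hΔ0 hf
  have hfnn : 0 < f (K1 L) := hf.1.2.2.1
  have hP := profileFromGreen_holds L (by omega) Δ lam2 f hf.1 hpos hlt r hr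
  have hc := cS_mul_Gres_zero L hL hΔ0 hΔ1 hf
  have hG := abs_Gres_le L (by omega) hlt r
  have hcs : 0 ≤ cS L Δ lam2 f := by unfold cS; positivity
  have h1 : -(cS L Δ lam2 f * Gres L lam2 r) ≤ cS L Δ lam2 f * Gres L lam2 0 := by
    have := neg_abs_le (Gres L lam2 r)
    nlinarith
  rw [hP]
  calc 1 + Δ * f (K1 L) / (L : ℝ) ^ 2 - cS L Δ lam2 f * Gres L lam2 r
      ≤ 1 + Δ * f (K1 L) / (L : ℝ) ^ 2 + (1 + Δ * f (K1 L) / (L : ℝ) ^ 2 - Δ * f (K1 L)) := by linarith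
    _ = 2 - Δ * f (K1 L) * (1 - 2 / (L : ℝ) ^ 2) := by ring

/-- ★★ **`f(r) ≤ 2 − Δ·f(x̂)·(1 − 2/V)`** for every site `r`, for the ground profile (`L ≥ 5`, `0 ≤ Δ < 1`). [folklore] -/
theorem ground_le_two' (hL : 5 ≤ L) {Δ lam2 : ℝ} (hΔ0 : 0 ≤ Δ) (hΔ1 : Δ < 1) {f : Tor L → ℝ}
    (hf : IsGroundTwoMagnon L Δ lam2 f) (r : Tor L) :
    f r ≤ 2 - Δ * f (K1 L) * (1 - 2 / (L : ℝ) ^ 2) := by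
  by_cases hr : r = 0
  · rw [hr, hf.1.1]
    have hfnn : 0 < f (K1 L) := hf.1.2.2.1
    have h := ground_le_two_of_ne L hL hΔ0 hΔ1 hf (K1_ne_zero L (by omega))
    linarith
  · exact ground_le_two_of_ne L hL hΔ0 hΔ1 hf hr

/-- ★★ **`f ≤ 2`**: the ground two-magnon profile (mean one) never exceeds `2` (`L ≥ 5`, `0 ≤ Δ < 1`). [folklore] -/
theorem ground_le_two (hL : 5 ≤ L) {Δ lam2 : ℝ} (hΔ0 : 0 ≤ Δ) (hΔ1 : Δ < 1) {f : Tor L → ℝ}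
    (hf : IsGroundTwoMagnon L Δ lam2 f) (r : Tor L) : f r ≤ 2 := by
  have h := ground_le_two' L hL hΔ0 hΔ1 hf r
  have hfnn : 0 < f (K1 L) := hf.1.2.2.1
  have hV : (4 : ℝ) ≤ (L : ℝ) ^ 2 := by
    have : (2 : ℝ) ≤ L := by exact_mod_cast (show 2 ≤ L by omega)
    nlinarith
  have h2 : 0 ≤ 1 - 2 / (L : ℝ) ^ 2 := by
    have : 2 / (L : ℝ) ^ 2 ≤ 1 / 2 := by
      rw [div_le_div_iff₀ (by positivity) (by norm_num)]; linarith
    linarith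
  have : 0 ≤ Δ * f (K1 L) * (1 - 2 / (L : ℝ) ^ 2) := by positivity
  linarith

/-- the companion lower bound off the origin: `f(r) ≥ Δ·f(x̂)·(1 + 1/V)… ≥ Δ f(x̂)` — stated as `Δ f(x̂) ≤ f(r)`
(`L ≥ 5`, `0 ≤ Δ < 1`, `r ≠ 0`). [folklore] -/
theorem ground_ge_delta_mul (hL : 5 ≤ L) {Δ lam2 : ℝ} (hΔ0 : 0 ≤ Δ) (hΔ1 : Δ < 1) {f : Tor L → ℝ}
    (hf : IsGroundTwoMagnon L Δ lam2 f) {r : Tor L} (hr : r ≠ 0) : Δ * f (K1 L) ≤ f r := by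
  have hpos := lam2_pos L (by omega) hΔ1 hf.1
  have hlt := lam2_lt_two_eps1 L hL hΔ0 hf
  have hfnn : 0 < f (K1 L) := hf.1.2.2.1
  have hP := profileFromGreen_holds L (by omega) Δ lam2 f hf.1 hpos hlt r hr
  have hc := cS_mul_Gres_zero L hL hΔ0 hΔ1 hf
  have hG := abs_Gres_le L (by omega) hlt r
  have hcs : 0 ≤ cS L Δ lam2 f := by unfold cS; positivity
  have h1 : cS L Δ lam2 f * Gres L lam2 r ≤ cS L Δ lam2 f * Gres L lam2 0 := by
    have := le_abs_self (Gres L lam2 r)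
    nlinarith
  have hV : (0 : ℝ) < (L : ℝ) ^ 2 := by
    have : (0 : ℝ) < L := by exact_mod_cast (show 0 < L by omega)
    positivity
  have : 0 ≤ Δ * f (K1 L) / (L : ℝ) ^ 2 := by positivity
  rw [hP]
  linarith

/-! ## Consequences -/

/-- `Σ_r f(r)² ≤ 2V` for the ground profile (`L ≥ 5`, `0 ≤ Δ < 1`). [folklore] -/
theorem sum_ground_sq_le (hL : 5 ≤ L) {Δ lam2 : ℝ} (hΔ0 : 0 ≤ Δ) (hΔ1 : Δ < 1) {f : Tor L → ℝ}
    (hf : IsGroundTwoMagnon L Δ lam2 f) : ∑ r : Tor L, f r ^ 2 ≤ 2 * (L : ℝ) ^ 2 := by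
  have hsum : ∑ r : Tor L, f r = (L : ℝ) ^ 2 := hf.1.2.2.2.1
  calc ∑ r : Tor L, f r ^ 2 ≤ ∑ r : Tor L, 2 * f r := by
        refine Finset.sum_le_sum fun r _ => ?_
        have h0 := ground_nonneg L (by omega) hf r
        have h2 := ground_le_two L hL hΔ0 hΔ1 hf r
        nlinarith
    _ = 2 * (L : ℝ) ^ 2 := by rw [← Finset.mul_sum, hsum]

/-- `f(x̂) ≤ 2` and hence `η_eff = (1−Δ)f(x̂) ≤ 2(1−Δ)` (`L ≥ 5`, `0 ≤ Δ < 1`). [folklore] -/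
theorem etaEff_le_two (hL : 5 ≤ L) {Δ lam2 : ℝ} (hΔ0 : 0 ≤ Δ) (hΔ1 : Δ < 1) {f : Tor L → ℝ}
    (hf : IsGroundTwoMagnon L Δ lam2 f) : f (K1 L) ≤ 2 ∧ etaEff L lam2 ≤ 2 * (1 - Δ) := by
  have h := ground_le_two L hL hΔ0 hΔ1 hf (K1 L)
  refine ⟨h, ?_⟩
  rw [etaEff_eq L (by omega) hf.1]
  nlinarith

end Summit.HubbardSuperconductivity.HubbardSuperconductivity.Theorems.AnisotropyChord.Transfer.Fibre3

end
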